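import Literature.NumberTheory.Automorphic.AsaiSignContRankOne
import Literature.NumberTheory.Automorphic.AsaiSignContProofsL2
import HarnessLib

/-!
# Mok's Asai-pole dichotomy in continuation form: closed modulo its rank `≥ 2` inputs, `L²` form

Topic `NumberTheory/Automorphic`; namespace `Literature.NumberTheory.Automorphic`. Proof file
(one theorem; no definition, no named fact, no instance; provefact unit
`Mok2014_partialAsaiL_continuation_pole_dichotomy`, 2026-08-16), the join of `AsaiSignContRankOne`
(the named fact `Mok2014_partialAsaiL_continuation_pole_dichotomy` PROVED in rank `N = 1`, together
with the rank-one cases of the hypotheses `hHol`, `hNV`) and `AsaiSignContProofsL2`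
(`Mok2014_partialAsaiL_continuation_pole_dichotomy_of_holomorphy_of_L2`: the fact, in every rank, from
Grbac–Shahidi's holomorphy `hHol`, the tree's `L²` Rankin–Selberg named facts
`MoeglinWaldspurger1989_partialPairL_of_eq_conj`, `JacquetShalika1981_partialPairL_pole_of_eq_conj`, and
the absence of poles at `s = 1` of the unramified Asai factors `hNV`).

* `Mok2014_partialAsaiL_continuation_pole_dichotomy_of_holomorphy_of_L2_two_le` — **the named fact
  from `hHol` and `hNV` restricted to ranks `N ≥ 2`** and the two `L²` facts: the definitive
  "closed modulo" form. What remains of Mok, Thm. 2.5.4 (a) / Grbac–Shahidi, Thm. 4.3 (2) in the tree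
  is thus: (1) the holomorphy on `{1/2 < Re s}` of `(s - 1) L^S(s, Π, As^±)` for conjugate self-dual
  cuspidal `Π` on `GL_N(𝔸_E)`, `N ≥ 2` (Grbac–Shahidi 2015, Thm. 4.3 (2)(a): the Langlands–Shahidi
  method on `U(N, N)` with Mok's endoscopic classification — or Flicker's Asai Rankin–Selberg
  integral; neither is in the tree); (2) the two catalogued Rankin–Selberg facts (the Jacquet–Shalika
  one is proved for `N ≤ 2`, `JacquetShalika1981_partialPairL_pole_of_eq_conj_holds_of_le_two`); (3) `hNV`
  for `N ≥ 2` (Jacquet–Shalika I, Cor. 2.5 with the local–global dictionary).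

## References

* C. P. Mok, *Endoscopic classification of representations of quasi-split unitary groups*,
  Mem. Amer. Math. Soc. 235 (2015), no. 1108: §2.5 and Thm. 2.5.4 (a) (p. 20). [Mok2014]
* N. Grbac, F. Shahidi, *Endoscopic transfer for unitary groups and holomorphy of Asai
  `L`-functions*, Pacific J. Math. 276 (2015), Thm. 4.3 (2) and its proof, pp. 204–206.
  [GrbacShahidi2015]
* C. Mœglin, J.-L. Waldspurger, *Le spectre résiduel de `GL(n)`*, Ann. Sci. ÉNS 22 (1989),
  Appendice, Corollaire (ii). [MoeglinWaldspurger1989]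
* H. Jacquet, J. A. Shalika, *On Euler products and the classification of automorphic
  representations I*, Amer. J. Math. 103 (1981), Cor. 2.5, §4. [JacquetShalikaAJM1981]
-/

noncomputable section

open scoped Topology Classical
open NumberField IsDedekindDomain Filter MeasureTheory

namespace Literature.NumberTheory.Automorphic

open AdelicGroupData

/-- **Mok's Asai-pole dichotomy in continuation form, from its rank `≥ 2` inputs (`L²` form).**
`Mok2014_partialAsaiL_continuation_pole_dichotomy` follows from: `hHol₂` — for `[E : F] = 2`,
`c ≠ 1`, a conjugate self-dual cuspidal `Π` on `GL_N(𝔸_E)` with `N ≥ 2`, every Asai datum `(S, A)`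
and sign `η`, a continuation of `(s - 1) L^S(s, Π, As^η)` holomorphic on `{1/2 < Re s}`
(Grbac–Shahidi 2015, Thm. 4.3 (2)(a), holomorphy part, `N ≥ 2`); `hMW`, `hJS` — the tree's named
facts `MoeglinWaldspurger1989_partialPairL_of_eq_conj`, `JacquetShalika1981_partialPairL_pole_of_eq_conj`
over `E`, in rank `N`, for every automorphic measure; `hNV₂` — for such `Π` with `N ≥ 2`, an Asai datum,
a sign and an unramified `v ∉ S`, `det(1 - As^θ(t_v) q_v^{-1}) ≠ 0`. In rank one `hHol` and `hNV`
are the theorems `hol_half_plane_rank_one`, `eval_asaiLocalPolynomial_at_one_ne_zero_rank_one`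
(`AsaiSignContRankOne`), so `Mok2014_partialAsaiL_continuation_pole_dichotomy_of_holomorphy_of_L2`
applies. [cite: GrbacShahidi2015, Thm. 4.3 (2) and its proof, pp. 204–206]
[cite: Mok2014, §2.5 (paragraph before Thm. 2.5.4) and Thm. 2.5.4 (a)]
[cite: MoeglinWaldspurger1989, Appendice, Corollaire (ii)] [cite: JacquetShalikaAJM1981, Cor. 2.5] -/
theorem Mok2014_partialAsaiL_continuation_pole_dichotomy_of_holomorphy_of_L2_two_le
    (hHol₂ : ∀ (F E : Type) [Field F] [NumberField F] [Field E] [NumberField E] [Algebra F E]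
      (c : E ≃ₐ[F] E), Module.finrank F E = 2 → c ≠ 1 →
      ∀ (N : ℕ) (hcpt : isCompact_glFiniteIntegralLevel N E)
        (π : CuspidalAutomorphicRepData N E hcpt), 2 ≤ N → π.1.IsConjSelfDualAE c →
        ∀ (S : Set (HeightOneSpectrum (𝓞 F))) (A : SatakeFamily E) (η : ℤˣ),
          π.1.IsAsaiDatum c S A →
          ∃ σ₀ : ℝ, 1 ≤ σ₀ ∧ ∃ G : ℂ → ℂ, DifferentiableOn ℂ G {s : ℂ | 1 / 2 < s.re} ∧
            ∀ s : ℂ, σ₀ < s.re → G s = (s - 1) * partialAsaiL S c A η s)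
    (hMW : ∀ (E : Type) [Field E] [NumberField E] (N : ℕ)
      (μ : Measure (gl N E).automorphicQuotient) [(gl N E).IsAutomorphicMeasure μ],
      MoeglinWaldspurger1989_partialPairL_of_eq_conj (n := N) (K := E) (μ := μ))
    (hJS : ∀ (E : Type) [Field E] [NumberField E] (N : ℕ)
      (μ : Measure (gl N E).automorphicQuotient) [(gl N E).IsAutomorphicMeasure μ],
      JacquetShalika1981_partialPairL_pole_of_eq_conj (n := N) (K := E) (μ := μ))
    (hNV₂ : ∀ (F E : Type) [Field F] [NumberField F] [Field E] [NumberField E] [Algebra F E]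
      (c : E ≃ₐ[F] E), Module.finrank F E = 2 → c ≠ 1 →
      ∀ (N : ℕ) (hcpt : isCompact_glFiniteIntegralLevel N E)
        (π : CuspidalAutomorphicRepData N E hcpt), 2 ≤ N → π.1.IsConjSelfDualAE c →
        ∀ (S : Set (HeightOneSpectrum (𝓞 F))) (A : SatakeFamily E) (θ : ℤˣ),
          π.1.IsAsaiDatum c S A → ∀ v : HeightOneSpectrum (𝓞 F), v ∉ S →
            (asaiLocalPolynomial c A θ (placeAbove E v)).eval
              ((v.residueCard : ℂ) ^ (-(1 : ℂ))) ≠ 0) :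
    Mok2014_partialAsaiL_continuation_pole_dichotomy := by
  refine Mok2014_partialAsaiL_continuation_pole_dichotomy_of_holomorphy_of_L2 ?_ hMW hJS ?_
  · intro F E _ _ _ _ _ c h2 hc N hcpt π hN hπ S A η hSA
    rcases Nat.lt_or_ge N 2 with hN2 | hN2
    · obtain rfl : N = 1 := by omega
      exact hol_half_plane_rank_one h2 hc π hπ η hSA
    · exact hHol₂ F E c h2 hc N hcpt π hN2 hπ S A η hSA
  · intro F E _ _ _ _ _ c h2 hc N hcpt π hN hπ S A θ hSA v hv
    rcases Nat.lt_or_ge N 2 with hN2 | hN2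
    · obtain rfl : N = 1 := by omega
      exact eval_asaiLocalPolynomial_at_one_ne_zero_rank_one h2 hc π hπ θ hSA hv
    · exact hNV₂ F E c h2 hc N hcpt π hN2 hπ S A θ hSA v hv

end Literature.NumberTheory.Automorphic
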